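import Mathlib

-- `Summit.HodgeConjecture.HodgeConjecture.…` (summit = sub-problem for this single-conjunct summit) trips `linter.dupNamespace`
-- on every declaration; the duplication is the tree's naming convention (D-0017), as in the sibling census sheets.
set_option linter.dupNamespace false

/-!
# Hodge-locus census, Σ-family `F_N = N·F₀ + F₁` of the quartic cells `(2k′, 4, k′−1)` — the generic `(a,b)`-BRACKET STEP
# behind the reductions R1 / R2 of ENGINE B's chart routes, kernel-checked once for every `k′`

certified instances and evidence bearing on the general Hodge conjecture; no claim.

ENGINE B (unit `pub-hlocus-ivhs-2`, gen 37; LEAD ruling R-L279).  Def-free; imports Mathlib only.  In every quartic cell of the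
Σ-family (`e = 1`, any `k′ ≥ 2`; e.g. `(6,4,2)`, `(8,4,3)`, `(10,4,4)`) the member is
`F_N = N·(Σ_j (y_j x_j³ + y_j⁴) + a³b + ab³) − (x,y-couplings) + ab·x₀x₁`, and the ONLY partial derivatives involving the bracket
coordinates `a, b` are
`∂F_N/∂a = N·b(3a² + b²) + b·x₀x₁`,  `∂F_N/∂b = N·a(a² + 3b²) + a·x₀x₁`,
while `a, b` enter the `x`-partials only through the terms `ab·x₁` (in `∂/∂x₀`) and `ab·x₀` (in `∂/∂x₁`).  These four expressions do
not depend on `k′`.  This sheet settles their algebra over an arbitrary field `K` with the exact non-degeneracy hypotheses used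
(`2 ≠ 0`, `N ≠ 0`; nothing else):

* `bracket_iff` — THE BRACKET LOCUS: the two bracket partials vanish iff one of four strata holds —
  I `a = b = 0`;  II `a = 0, x₀x₁ = −N b²`;  III `b = 0, x₀x₁ = −N a²`;  IV `b = ±a, x₀x₁ = −4N a²`.
* `x0_ne_zero_and_x1_ne_zero_of_bracket` — REDUCTION R1's engine: off stratum I the bracket partials force `x₀ ≠ 0` and `x₁ ≠ 0`
  (so a singular point off stratum I lies in the chart `x₁ = 1`, resp. has `(x,y) ≠ 0`).
* `caseIV_of_bracket` — REDUCTION R2's first half: `ab ≠ 0` and the bracket partials give `b = ε·a` with `ε = ±1` and `x₀x₁ = −4N a²`.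
* `caseIV_correction` — R2's second half: under `b = ε·a`, `x₀x₁ = −4N a²` (any `ε`) the bracket contributions to the `x`-partials are
  `ab·x₁ = −(ε/(4N))·x₀x₁²` and `ab·x₀ = −(ε/(4N))·x₀²x₁` — the coefficient `r = (−ε)(4N)⁻¹` that ENGINE B's registered chart systems
  `T±` carry on the monomials `x₀x₁²`, `x₀²x₁` (cell sheets: `HodgeLocusCensusSigmaFamilyRouteT4Charts`, theorem `caseIV_chart`, for
  `k′ = 5`); `caseIV_correction_iff` is the same fact as a rewriting of the two `x`-partial equations with arbitrary remaining terms.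
* `bracket_of_caseII`, `bracket_of_caseIII`, `bracket_of_caseIV` — the converse identities (exactness of the strata; the 'conversely'
  direction of R2 used for anomaly witnesses).

Nothing here is specific to one cell, and nothing here is a smoothness statement: the cell sheets combine these lemmas with their own
`x,y`-chart systems and with the COMPUTATIONS OF RECORD ('1 ∈ chart ideal over 𝔽_p', external, not Lean statements).
-/

namespace Summit.HodgeConjecture.HodgeConjecture.HodgeLocus.Census.SigmaFamilyBracket

variable {K : Type*} [Field K]

/-- Stratum IV from the bracket partials: if `a ≠ 0`, `b ≠ 0`, `2 ≠ 0`, `N ≠ 0` and both bracket partials vanish, then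
`b = ±a` and `x₀x₁ = −4N a²` (reduction R2, first half). -/
theorem caseIV_of_bracket (N a b x0 x1 : K) (hN : N ≠ 0) (h2 : (2 : K) ≠ 0) (ha : a ≠ 0) (hb : b ≠ 0)
    (Ha : N * (b * (3 * a ^ 2 + b ^ 2)) + b * x0 * x1 = 0)
    (Hb : N * (a * (a ^ 2 + 3 * b ^ 2)) + a * x0 * x1 = 0) :
    (b = a ∨ b = -a) ∧ x0 * x1 = -(4 * N * a ^ 2) := by
  -- cancel `b` from `Ha` and `a` from `Hb`
  have Ha' : N * (3 * a ^ 2 + b ^ 2) + x0 * x1 = 0 := by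
    have h : b * (N * (3 * a ^ 2 + b ^ 2) + x0 * x1) = 0 := by linear_combination Ha
    rcases mul_eq_zero.mp h with h | h
    · exact absurd h hb
    · exact h
  have Hb' : N * (a ^ 2 + 3 * b ^ 2) + x0 * x1 = 0 := by
    have h : a * (N * (a ^ 2 + 3 * b ^ 2) + x0 * x1) = 0 := by linear_combination Hb
    rcases mul_eq_zero.mp h with h | h
    · exact absurd h ha
    · exact h
  -- subtract: `2N(a² − b²) = 0`, so `(b − a)(b + a) = 0`
  have hsq : (b - a) * (b + a) = 0 := by
    have h : (2 * N) * ((b - a) * (b + a)) = 0 := by linear_combination Hb' - Ha'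
    rcases mul_eq_zero.mp h with h | h
    · exact absurd h (mul_ne_zero h2 hN)
    · exact h
  have hε : b = a ∨ b = -a := by
    rcases mul_eq_zero.mp hsq with h | h
    · exact Or.inl (by linear_combination h)
    · exact Or.inr (by linear_combination h)
  refine ⟨hε, ?_⟩
  have hb2 : b ^ 2 = a ^ 2 := by
    rcases hε with h | h <;> · subst h; ring
  linear_combination Ha' - N * hb2

/-- THE BRACKET LOCUS (`2 ≠ 0`, `N ≠ 0`): the two bracket partials `∂F_N/∂a`, `∂F_N/∂b` vanish iff the point lies on one of the
four strata I `a = b = 0`, II `a = 0 ∧ x₀x₁ = −N b²`, III `b = 0 ∧ x₀x₁ = −N a²`, IV `b = ±a ∧ x₀x₁ = −4N a²`. -/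
theorem bracket_iff (N a b x0 x1 : K) (hN : N ≠ 0) (h2 : (2 : K) ≠ 0) :
    (N * (b * (3 * a ^ 2 + b ^ 2)) + b * x0 * x1 = 0 ∧ N * (a * (a ^ 2 + 3 * b ^ 2)) + a * x0 * x1 = 0) ↔
    ((a = 0 ∧ b = 0) ∨ (a = 0 ∧ x0 * x1 = -(N * b ^ 2)) ∨ (b = 0 ∧ x0 * x1 = -(N * a ^ 2)) ∨
      ((b = a ∨ b = -a) ∧ x0 * x1 = -(4 * N * a ^ 2))) := by
  constructor
  · rintro ⟨Ha, Hb⟩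
    by_cases ha : a = 0
    · by_cases hb : b = 0
      · exact Or.inl ⟨ha, hb⟩
      · -- stratum II: cancel `b` from `Ha` (with `a = 0`)
        subst ha
        have h : b * (N * b ^ 2 + x0 * x1) = 0 := by linear_combination Ha
        rcases mul_eq_zero.mp h with h | h
        · exact absurd h hb
        · exact Or.inr (Or.inl ⟨rfl, by linear_combination h⟩)
    · by_cases hb : b = 0
      · -- stratum III: cancel `a` from `Hb` (with `b = 0`)
        subst hb
        have h : a * (N * a ^ 2 + x0 * x1) = 0 := by linear_combination Hb
        rcases mul_eq_zero.mp h with h | h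
        · exact absurd h ha
        · exact Or.inr (Or.inr (Or.inl ⟨rfl, by linear_combination h⟩))
      · exact Or.inr (Or.inr (Or.inr (caseIV_of_bracket N a b x0 x1 hN h2 ha hb Ha Hb)))
  · rintro (⟨ha, hb⟩ | ⟨ha, hm⟩ | ⟨hb, hm⟩ | ⟨hε, hm⟩)
    · subst ha; subst hb; constructor <;> ring
    · subst ha
      exact ⟨by linear_combination b * hm, by ring⟩
    · subst hb
      exact ⟨by ring, by linear_combination a * hm⟩
    · rcases hε with h | h
      · subst h
        exact ⟨by linear_combination b * hm, by linear_combination b * hm⟩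
      · subst h
        exact ⟨by linear_combination (-a) * hm, by linear_combination a * hm⟩

/-- REDUCTION R1's engine: off stratum I (`(a,b) ≠ (0,0)`) the bracket partials force `x₀ ≠ 0` and `x₁ ≠ 0`
(`2 ≠ 0`, `N ≠ 0`). -/
theorem x0_ne_zero_and_x1_ne_zero_of_bracket (N a b x0 x1 : K) (hN : N ≠ 0) (h2 : (2 : K) ≠ 0)
    (hab : ¬ (a = 0 ∧ b = 0))
    (Ha : N * (b * (3 * a ^ 2 + b ^ 2)) + b * x0 * x1 = 0)
    (Hb : N * (a * (a ^ 2 + 3 * b ^ 2)) + a * x0 * x1 = 0) :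
    x0 ≠ 0 ∧ x1 ≠ 0 := by
  have h4 : (4 : K) ≠ 0 := by
    have : (4 : K) = 2 * 2 := by norm_num
    rw [this]; exact mul_ne_zero h2 h2
  have hm : x0 * x1 ≠ 0 := by
    rcases (bracket_iff N a b x0 x1 hN h2).mp ⟨Ha, Hb⟩ with ⟨ha, hb⟩ | ⟨ha, hm⟩ | ⟨hb, hm⟩ | ⟨hε, hm⟩
    · exact absurd ⟨ha, hb⟩ hab
    · have hb : b ≠ 0 := fun hb => hab ⟨ha, hb⟩
      rw [hm]; exact neg_ne_zero.mpr (mul_ne_zero hN (pow_ne_zero 2 hb))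
    · have ha : a ≠ 0 := fun ha => hab ⟨ha, hb⟩
      rw [hm]; exact neg_ne_zero.mpr (mul_ne_zero hN (pow_ne_zero 2 ha))
    · have ha : a ≠ 0 := by
        rintro rfl
        rcases hε with h | h <;> exact hab ⟨rfl, by simpa using h⟩
      rw [hm]; exact neg_ne_zero.mpr (mul_ne_zero (mul_ne_zero h4 hN) (pow_ne_zero 2 ha))
  exact ⟨left_ne_zero_of_mul hm, right_ne_zero_of_mul hm⟩

/-- REDUCTION R2, second half — the `T_ε` correction.  On stratum IV (`b = ε·a`, `x₀x₁ = −4N a²`; `2 ≠ 0`, `N ≠ 0`) the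
bracket contributions to `∂F_N/∂x₀` and `∂F_N/∂x₁` are `ab·x₁ = −(ε/(4N))·x₀x₁²` and `ab·x₀ = −(ε/(4N))·x₀²x₁`
(an identity linear in `ε`, so no hypothesis `ε = ±1` is needed; in the application `ε = ±1` by `caseIV_of_bracket`). -/
theorem caseIV_correction (N ε a b x0 x1 : K) (hN : N ≠ 0) (h2 : (2 : K) ≠ 0)
    (hb : b = ε * a) (hm : x0 * x1 = -(4 * N * a ^ 2)) :
    a * b * x1 = -(ε / (4 * N)) * (x0 * x1 ^ 2) ∧ a * b * x0 = -(ε / (4 * N)) * (x0 ^ 2 * x1) := by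
  have h4N : (4 : K) * N ≠ 0 := by
    have : (4 : K) = 2 * 2 := by norm_num
    rw [this]; exact mul_ne_zero (mul_ne_zero h2 h2) hN
  have hr : ε / (4 * N) * (4 * N) = ε := div_mul_cancel₀ ε h4N
  subst hb
  constructor
  · linear_combination (ε / (4 * N) * x1) * hm + (-(a ^ 2 * x1)) * hr
  · linear_combination (ε / (4 * N) * x0) * hm + (-(a ^ 2 * x0)) * hr

/-- The same correction as a rewriting of the two `x`-partial equations, for arbitrary remaining terms `R₀`, `R₁`
(the registered systems `T±` replace `+ ab·x₁`, `+ ab·x₀` by `− (ε/(4N))·x₀x₁²`, `− (ε/(4N))·x₀²x₁`). -/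
theorem caseIV_correction_iff (N ε a b x0 x1 R₀ R₁ : K) (hN : N ≠ 0) (h2 : (2 : K) ≠ 0)
    (hb : b = ε * a) (hm : x0 * x1 = -(4 * N * a ^ 2)) :
    (R₀ + a * b * x1 = 0 ↔ R₀ - ε / (4 * N) * (x0 * x1 ^ 2) = 0) ∧
      (R₁ + a * b * x0 = 0 ↔ R₁ - ε / (4 * N) * (x0 ^ 2 * x1) = 0) := by
  obtain ⟨h0, h1⟩ := caseIV_correction N ε a b x0 x1 hN h2 hb hm
  constructor
  · rw [h0]; constructor <;> intro h <;> linear_combination h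
  · rw [h1]; constructor <;> intro h <;> linear_combination h

/-- Exactness, stratum II: `a = 0` and `x₀x₁ = −N b²` make both bracket partials vanish. -/
theorem bracket_of_caseII (N b x0 x1 : K) (hm : x0 * x1 = -(N * b ^ 2)) :
    N * (b * (3 * (0 : K) ^ 2 + b ^ 2)) + b * x0 * x1 = 0 ∧ N * (0 * ((0 : K) ^ 2 + 3 * b ^ 2)) + 0 * x0 * x1 = 0 :=
  ⟨by linear_combination b * hm, by ring⟩

/-- Exactness, stratum III: `b = 0` and `x₀x₁ = −N a²` make both bracket partials vanish. -/
theorem bracket_of_caseIII (N a x0 x1 : K) (hm : x0 * x1 = -(N * a ^ 2)) :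
    N * (0 * (3 * a ^ 2 + (0 : K) ^ 2)) + 0 * x0 * x1 = 0 ∧ N * (a * (a ^ 2 + 3 * (0 : K) ^ 2)) + a * x0 * x1 = 0 :=
  ⟨by ring, by linear_combination a * hm⟩

/-- Exactness, stratum IV ('conversely' of R2): `b = ε·a`, `ε = ±1`, `x₀x₁ = −4N a²` make both bracket partials vanish. -/
theorem bracket_of_caseIV (N ε a x0 x1 : K) (hε : ε = 1 ∨ ε = -1) (hm : x0 * x1 = -(4 * N * a ^ 2)) :
    N * ((ε * a) * (3 * a ^ 2 + (ε * a) ^ 2)) + (ε * a) * x0 * x1 = 0 ∧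
      N * (a * (a ^ 2 + 3 * (ε * a) ^ 2)) + a * x0 * x1 = 0 := by
  have he : ε ^ 2 = 1 := by
    rcases hε with h | h <;> · subst h; ring
  constructor
  · linear_combination (ε * a) * hm + (N * ε * a ^ 3) * he
  · linear_combination a * hm + (3 * N * a ^ 3) * he

end Summit.HodgeConjecture.HodgeConjecture.HodgeLocus.Census.SigmaFamilyBracket
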